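import Mathlib

/-!
# Crux `MatrixDescartes` (stmt-ValiantsHypothesis-18050), line `Lift` — registered stub `stub_kroneckerSector`

KRONECKER PRODUCTS OF LACUNARY PENCILS ARE ADDITIVE in the count of distinct real zeros.
For real square matrices `Sₗ` (`l : Fin K`, size `m`) and `Tₖ` (`k : Fin K'`, size `n`) and exponents
`dₗ`, `eₖ`, the pencil `∑_{(l,k)} X^{dₗ+eₖ} • (Sₗ ⊗ₖ Tₖ)` is the Kronecker product `A ⊗ₖ B` of the
pencils `A := ∑ₗ X^{dₗ} • Sₗ` and `B := ∑ₖ X^{eₖ} • Tₖ` (bilinearity of `Matrix.kroneckerMap (· * ·)`,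
checked entrywise: `StubKroneckerSector.pencil_kronecker`), so by `Matrix.det_kronecker`
`det (A ⊗ₖ B) = det A ^ n * det B ^ m`, whose distinct real roots lie among those of `det A` and
`det B` (`StubKroneckerSector.card_roots_pow_mul_pow_le`; if the product is the zero polynomial no
root is counted).  Hence `Z(A ⊗ₖ B) ≤ Z(A) + Z(B)` (`stub_kroneckerSector`).

Elementary; Mathlib only (axioms `propext`, `Classical.choice`, `Quot.sound`).
-/

-- layout Summits/ValiantsHypothesis/ValiantsHypothesis forces the duplicated namespace component
set_option linter.dupNamespace false

namespace Summit.ValiantsHypothesis.ValiantsHypothesis.Theorems.LacunarySymmetroidMatrixDescartes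

open Polynomial Matrix Finset
open scoped BigOperators

namespace StubKroneckerSector

variable {ι ι' κ κ' : Type} [Fintype κ] [Fintype κ']

/-- The Kronecker pencil `∑_{(l,k)} X^{dₗ+eₖ} • (Sₗ ⊗ₖ Tₖ)` is the Kronecker product of the pencils
`∑ₗ X^{dₗ} • Sₗ` and `∑ₖ X^{eₖ} • Tₖ` (entrywise: `∑_{(l,k)} X^{dₗ+eₖ} C(s t) = (∑ₗ X^{dₗ} C s) (∑ₖ X^{eₖ} C t)`). -/
theorem pencil_kronecker (d : κ → ℕ) (e : κ' → ℕ) (S : κ → Matrix ι ι ℝ)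
    (T : κ' → Matrix ι' ι' ℝ) :
    (∑ p : κ × κ', ((Polynomial.X : Polynomial ℝ) ^ (d p.1 + e p.2)) •
        (Matrix.kroneckerMap (· * ·) (S p.1) (T p.2)).map Polynomial.C)
      = Matrix.kroneckerMap (· * ·)
          (∑ l, ((Polynomial.X : Polynomial ℝ) ^ d l) • (S l).map Polynomial.C)
          (∑ k, ((Polynomial.X : Polynomial ℝ) ^ e k) • (T k).map Polynomial.C) := by
  refine Matrix.ext ?_
  rintro ⟨i, i'⟩ ⟨j, j'⟩
  simp only [Matrix.sum_apply, Matrix.smul_apply, Matrix.map_apply, Matrix.kroneckerMap_apply,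
    smul_eq_mul, Polynomial.C_mul, Fintype.sum_prod_type, Finset.sum_mul_sum]
  refine Finset.sum_congr rfl fun l _ => Finset.sum_congr rfl fun k _ => ?_
  rw [pow_add]
  ring

/-- The elements of a scalar multiple `a • μ` of a multiset lie in `μ`. -/
theorem toFinset_nsmul_subset {α : Type} [DecidableEq α] (μ : Multiset α) (a : ℕ) :
    (a • μ).toFinset ⊆ μ.toFinset := by
  intro x hx
  rw [Multiset.mem_toFinset] at hx ⊢
  exact Multiset.mem_of_mem_nsmul hx

/-- The distinct roots of `P ^ a * Q ^ b` number at most those of `P` plus those of `Q`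
(if the product is the zero polynomial, no root is counted). -/
theorem card_roots_pow_mul_pow_le (P Q : Polynomial ℝ) (a b : ℕ) :
    (P ^ a * Q ^ b).roots.toFinset.card ≤ P.roots.toFinset.card + Q.roots.toFinset.card := by
  by_cases h0 : P ^ a * Q ^ b = 0
  · simp [h0]
  rw [Polynomial.roots_mul h0, Polynomial.roots_pow, Polynomial.roots_pow, Multiset.toFinset_add]
  exact (Finset.card_union_le _ _).trans (add_le_add
    (Finset.card_le_card (toFinset_nsmul_subset _ _))
    (Finset.card_le_card (toFinset_nsmul_subset _ _)))

end StubKroneckerSector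

/-- **Registered stub `stub_kroneckerSector`** (Kronecker products are additive): the Kronecker product
of two lacunary pencils is the lacunary pencil `∑_{(l,k)} X^{dₗ+eₖ} (Sₗ ⊗ₖ Tₖ)` (bilinearity of
`Matrix.kroneckerMap`), and `det (A ⊗ₖ B) = det A ^ n · det B ^ m` (`Matrix.det_kronecker`), so its
distinct real zeros number at most `Z(S) + Z(T)`. -/
theorem stub_kroneckerSector (K K' m n : ℕ) (d : Fin K → ℕ) (e : Fin K' → ℕ)
    (S : Fin K → Matrix (Fin m) (Fin m) ℝ) (T : Fin K' → Matrix (Fin n) (Fin n) ℝ) :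
    (Matrix.det (∑ p : Fin K × Fin K', ((Polynomial.X : Polynomial ℝ) ^ (d p.1 + e p.2)) •
        (Matrix.kroneckerMap (· * ·) (S p.1) (T p.2)).map Polynomial.C)).roots.toFinset.card
      ≤ (Matrix.det (∑ l, ((Polynomial.X : Polynomial ℝ) ^ d l) • (S l).map Polynomial.C)).roots.toFinset.card
        + (Matrix.det (∑ k, ((Polynomial.X : Polynomial ℝ) ^ e k) • (T k).map Polynomial.C)).roots.toFinset.card := by
  rw [StubKroneckerSector.pencil_kronecker, Matrix.det_kronecker]
  exact StubKroneckerSector.card_roots_pow_mul_pow_le _ _ _ _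

end Summit.ValiantsHypothesis.ValiantsHypothesis.Theorems.LacunarySymmetroidMatrixDescartes
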